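import Summits.QuantumFields.BalabanUV.Beta.VariantCutoffRoad
import Summits.QuantumFields.BalabanUV.Beta.PkDecoupledTerms

/-!
# Beta / VariantCutoffRoadColumns — road P2″ («[II] Lemma 3 at the [III] (3.16) cut-off»), two complements:
# (§1) the γ-clauses of road P2″ are JOINTLY SATISFIABLE with the threshold (skeleton v2.0 NODE T, T.3);
# (§2) for the 𝐏^{(k)} columns T3/T5/T6 the substitution `ε₁ ↦ δ(g_k)` is LITERAL INSTANTIATION of the row owner's
# kernel (1.43)-analogue (`PkDecoupledTerms.norm_cauchyOp_Qop_le_exp`, whose ε₁ is the displayed bound on `‖g‖‖B‖`)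
# (β sub-cell, unit `b2b-balaban-beta-d4-p2`, generation 2; AUDIT-EPS1-PROVENANCE.md row #16 + kernel cross-check)

HONEST FRAMING (page 1 of everything the β sub-cell writes): discharging `BetaPertH` makes Bałaban's UV stability
UNCONDITIONAL — a real constructive-QFT result; it is NOT the continuum limit and NOT the Clay problem.  HONEST DEPENDENCY
(cell reorg 2026-08-19, verbatim): «continuum YM on T⁴ ⇐ BetaPertH ∧ nine spine estimates (0/9 proved); BetaPertH ⇐ (D1) ∧
(D4) ∧ CAP+tail; G-an2-4 gates asym, D1 and NE2/3/4.»  THIS MODULE INSTANTIATES NO BINDER: §1 is real analysis on the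
function `δ(g) = A₁g(log g⁻²)^{p₀}`; §2 applies the row owner's UNMODIFIED theorem BY NAME at a particular value of its
real parameter ε₁.  Nothing is cited as a fact (ABSOLUTE RULE).

WHAT §2 SHOWS AND DOES NOT SHOW.  [Balaban1988RG2Cluster] (1.43) p. 11 prints `|Q(Y,B,b,b′)| ≤ C₃ε₁M⁴…`; the cell's
kernel reproduction of the mechanism for the term types T3/T5/T6 (`PkDecoupledTerms`, row owner an4) states it with ε₁ a
real PARAMETER entering only through `‖g‖·‖B‖ ≤ ε₁` and `3ε₁ ≤ R`.  On the variant box `‖B‖ ≤ r(‖g‖)`,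
`r = p0Profile A₁ p₀`, one has `‖g‖‖B‖ ≤ δ(‖g‖)` (`deltaOf`), so the SAME theorem gives the bound with `δ(‖g‖)` in place
of ε₁ — road P2″'s reading (AUDIT row #16) is, for these columns, an instantiation, not an interpretation.  It does NOT
show anything about the columns the cell has not reproduced (road P1's leaf (T4)(b) by-similarity passages), nor about
Lemma 3 itself (the open apex).
-/

namespace Summit.QuantumFields.BalabanUV.Beta.VariantCutoffRoadColumns

open Literature.MathematicalPhysics.QuantumFieldTheory.Balaban1983to89
open Literature.MathematicalPhysics.QuantumFieldTheory.Balaban1983to89.B13PkScaling (Qop scaled)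
open Literature.MathematicalPhysics.QuantumFieldTheory.Balaban1983to89.B13Sect1Arith (cauchyOp)
open Literature.MathematicalPhysics.QuantumFieldTheory.Balaban1983to89.Beta.RemainderChainLattice (remCoeffL)
open Summit.QuantumFields.BalabanUV.Beta.RoadP2Chain (exists_threshold)
open Summit.QuantumFields.BalabanUV.Beta.CutoffVariant316
open Summit.QuantumFields.BalabanUV.Beta.VariantCutoffRoad
open Summit.QuantumFields.BalabanUV.Beta.PkDecoupledTerms (Cstr norm_cauchyOp_Qop_le_exp)
open Metric Filter Topology Set

noncomputable section

/-! ## §1 Joint satisfiability of road P2″'s hypotheses with the threshold (skeleton NODE T, leaf T.3) -/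

/-- **THE γ-CLAUSES OF ROAD P2″ ARE JOINTLY SATISFIABLE WITH THE THRESHOLD.**  Given the ε₁-FREE conditions of the
row owner (`CondsL0`: large/A₂/tree), the closing condition R22, `C₃ ≥ 0`, `A₁ ≥ 0`, and ANY drift constant `b > 0` and
box bound `γ₀ > 0`, there is `γ₁ ∈ ]0, γ₀]` at which ALL of road P2″'s hypotheses `Hyps d γ₁ c ℓ A₁ p₀` hold
(`γ₁ ≤ e^{−p₀}`, Kotecký–Preiss smallness `kpCoeff·δ(γ₁) ≤ 1`) AND the threshold `δ(γ₁)·K_rem,L < b` is met — because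
`δ(g) → 0` as `g → 0⁺`.  (Road P1's analogue: `RemainderWitness`/`RemainderChainKP.exists_eps1_lt_and_le` choose ε₁; here
nothing but γ is chosen, and γ is last in the printed order of constants.) -/
theorem exists_gamma_hyps {d : ℕ} {c : B13.Consts} {ℓ A₁ : ℝ} {p₀ : ℕ} (h0 : CondsL0 d c ℓ) (h22 : c.R22gen ℓ)
    (hC3 : 0 ≤ c.C3act) (hA₁ : 0 ≤ A₁) (M : ℕ) (α₂ B₃ : ℝ) {b γ₀ : ℝ} (hb : 0 < b) (hγ₀ : 0 < γ₀) :
    ∃ γ₁ : ℝ, 0 < γ₁ ∧ γ₁ ≤ γ₀ ∧ Hyps d γ₁ c ℓ A₁ p₀ ∧ deltaOf A₁ p₀ γ₁ * remCoeffL d M c α₂ B₃ < b := by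
  have hδ := tendsto_deltaOf A₁ p₀
  -- (i) Kotecký–Preiss smallness eventually: kpCoeff·δ(g) → 0 < 1
  have h1 : ∀ᶠ g in 𝓝[>] (0 : ℝ), kpCoeff d c * deltaOf A₁ p₀ g < 1 := by
    have h := hδ.const_mul (kpCoeff d c)
    rw [mul_zero] at h
    exact h.eventually (gt_mem_nhds zero_lt_one)
  -- (ii) the threshold eventually: δ(g)·K_rem,L → 0 < b
  have h2 : ∀ᶠ g in 𝓝[>] (0 : ℝ), deltaOf A₁ p₀ g * remCoeffL d M c α₂ B₃ < b := by
    have h := hδ.mul_const (remCoeffL d M c α₂ B₃)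
    rw [zero_mul] at h
    exact h.eventually (gt_mem_nhds hb)
  -- (iii) the box: g ∈ ]0, min{γ₀, e^{−p₀}}[ eventually
  have h3 : ∀ᶠ g in 𝓝[>] (0 : ℝ), g ∈ Ioo 0 (min γ₀ (Real.exp (-(p₀ : ℝ)))) :=
    Ioo_mem_nhdsGT (lt_min hγ₀ (Real.exp_pos _))
  obtain ⟨g, ⟨hg1, hg2⟩, hg3⟩ := ((h1.and h2).and h3).exists
  refine ⟨g, hg3.1, hg3.2.le.trans (min_le_left _ _), ?_, hg2⟩
  exact ⟨h0, h22, hC3, hA₁, hg3.2.le.trans (min_le_right _ _), hg1.le⟩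

/-- Corollary: under the same data there is a box `]0,γ₁]` on which BOTH conclusions of `VariantCutoffRoad` are
available — the ω-form/constant form of (D4) (given a road-P2″ chain on that box) and (hr) `δ(γ₁)·K_rem,L < b`. -/
theorem exists_gamma_remainderConst_lt {d M : ℕ} [NeZero M] {μ ν : Fin d} {β : FlowStep.HBeta}
    {S : B12Beta.OneLoopSplit β} {γ₀ : ℝ} {c : B13.Consts} {ℓ α₂ B₃ A₁ : ℝ} {p₀ : ℕ}
    (R : ChainTδ d M μ ν S γ₀ c ℓ α₂ B₃ A₁ p₀) (h0 : CondsL0 d c ℓ) (h22 : c.R22gen ℓ) (hC3 : 0 ≤ c.C3act)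
    (hA₁ : 0 ≤ A₁) (hα₂ : 0 < α₂) (hB₃ : 0 ≤ B₃) (hδ₀ : 0 < c.δ₀) (hd : 0 < d) {b : ℝ} (hb : 0 < b) (hγ₀ : 0 < γ₀) :
    ∃ γ₁ : ℝ, 0 < γ₁ ∧ γ₁ ≤ γ₀ ∧
      Beta.RemainderChain.RemainderConst S γ₁ (deltaOf A₁ p₀ γ₁ * remCoeffL d M c α₂ B₃) ∧
      deltaOf A₁ p₀ γ₁ * remCoeffL d M c α₂ B₃ < b := by
  obtain ⟨γ₁, hγ₁, hγ₁₀, H, hlt⟩ := exists_gamma_hyps h0 h22 hC3 hA₁ M α₂ B₃ hb hγ₀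
  refine ⟨γ₁, hγ₁, hγ₁₀, ?_, hlt⟩
  -- restrict the chain to the smaller box and apply the constant form there
  let R' : ChainTδ d M μ ν S γ₁ c ℓ α₂ B₃ A₁ p₀ :=
    { P1 := R.P1
      beta1_eq := fun k p hp => R.beta1_eq k p fun i => ⟨(hp i).1, (hp i).2.trans hγ₁₀⟩
      leaves := fun k p hp => R.leaves k p fun i => ⟨(hp i).1, (hp i).2.trans hγ₁₀⟩ }
  exact R'.remainderConst H hα₂ hB₃ hδ₀ hd

/-! ## §2 The (1.43)-column at the substituted smallness: instantiation of the row owner's theorem -/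

variable {ι : Type*} [DecidableEq ι]
  {E : Type*} [NormedAddCommGroup E] [NormedSpace ℂ E] {G : Type*} [NormedAddCommGroup G] [NormedSpace ℂ G]

omit [NormedSpace ℂ E] in
/-- On the variant box `‖B‖ ≤ r(‖g‖)` the scaled field has size `‖g‖‖B‖ ≤ δ(‖g‖)` — the one-line fact behind every
class-(a) row of the AUDIT. -/
theorem norm_mul_norm_le_deltaOf {A₁ : ℝ} {p₀ : ℕ} {g : ℂ} {B : E} (hB : ‖B‖ ≤ p0Profile A₁ p₀ ‖g‖) :
    ‖g‖ * ‖B‖ ≤ deltaOf A₁ p₀ ‖g‖ :=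
  mul_le_mul_of_nonneg_left hB (norm_nonneg g)

/-- **THE (1.43)-ANALOGUE AT THE SUBSTITUTED SMALLNESS** (term types T3/T5/T6; any family `W s σ` with a uniform cubic
constant `Kc` on `‖z‖ < R`, analytic there): on the variant box `‖B‖ ≤ r(‖g‖)` the decoupled operator of the quadratic
form obeys `‖∏∫ds∮dσ∕(σ−s)² · Q_{s,σ}(B)‖ ≤ exp(−(κ₁−1)·#cubes)·½·27·Kc·δ(‖g‖)` — the row owner's
`PkDecoupledTerms.norm_cauchyOp_Qop_le_exp` with its parameter ε₁ := δ(‖g‖).  The domain hypothesis of print,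
`3ε₁ ≤ R`, is kept at [II]'s ε₁ and met a fortiori through `δ(‖g‖) ≤ ε₁` (`VariantCutoffRoad.deltaOf_le_of_le_gammaC`:
`‖g‖ ≤ γ_c(ε₁)`) — AUDIT classes (c) and (a) respectively.  (‖g‖ ≤ 1, A₁ ≥ 0 for the sign of δ.) -/
theorem norm_cauchyOp_Qop_le_exp_variant {l : List ι} {κ₁ : ℝ} (hκ : 1 ≤ κ₁)
    {W : (ι → ℝ) → (ι → ℂ) → E → G} {R Kc ε₁ A₁ : ℝ} {p₀ : ℕ} {g : ℂ} (hg : g ≠ 0) (hg1 : ‖g‖ ≤ 1)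
    (hK0 : 0 ≤ Kc) (hR : 0 < R) (hA₁ : 0 ≤ A₁)
    (hW : ∀ s σ, (s, σ) ∈ Cstr l (Real.exp κ₁) → AnalyticOnNhd ℂ (W s σ) (ball 0 R))
    (hK : ∀ s σ, (s, σ) ∈ Cstr l (Real.exp κ₁) → ∀ z ∈ ball (0 : E) R, ‖W s σ z‖ ≤ Kc * ‖z‖ ^ 3)
    (h3 : 3 * ε₁ ≤ R) (hδε : deltaOf A₁ p₀ ‖g‖ ≤ ε₁)
    {B : E} (hB : ‖B‖ ≤ p0Profile A₁ p₀ ‖g‖) {s : ι → ℝ} {σ : ι → ℂ} (hsσ : (s, σ) ∈ Cstr l (Real.exp κ₁)) :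
    ‖cauchyOp (Real.exp κ₁) l (fun s σ => Qop (scaled g (W s σ)) B) s σ‖ ≤
      Real.exp (-(κ₁ - 1) * l.length) * (1 / 2 * (27 * Kc * deltaOf A₁ p₀ ‖g‖)) :=
  norm_cauchyOp_Qop_le_exp hκ hg hK0 hR (deltaOf_nonneg hA₁ p₀ (norm_pos_iff.2 hg) hg1) hW hK
    (by linarith [hδε]) (norm_mul_norm_le_deltaOf hB) hsσ

/-- The same bound with the substituted smallness DISPLAYED AS A FUNCTION OF THE COUPLING, `δ(‖g‖) = A₁‖g‖(log ‖g‖⁻²)^{p₀}`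
— linear in `‖g‖` up to the polylogarithm, uniformly in the decoupling parameters: the g_k-GAIN that road P1's census
V4 asks of the «g_k|B|-form», obtained on the (3.16) box with NO estimate beyond the owner's. -/
theorem norm_cauchyOp_Qop_le_coupling {l : List ι} {κ₁ : ℝ} (hκ : 1 ≤ κ₁)
    {W : (ι → ℝ) → (ι → ℂ) → E → G} {R Kc ε₁ A₁ : ℝ} {p₀ : ℕ} {g : ℂ} (hg : g ≠ 0) (hg1 : ‖g‖ ≤ 1)
    (hK0 : 0 ≤ Kc) (hR : 0 < R) (hA₁ : 0 ≤ A₁)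
    (hW : ∀ s σ, (s, σ) ∈ Cstr l (Real.exp κ₁) → AnalyticOnNhd ℂ (W s σ) (ball 0 R))
    (hK : ∀ s σ, (s, σ) ∈ Cstr l (Real.exp κ₁) → ∀ z ∈ ball (0 : E) R, ‖W s σ z‖ ≤ Kc * ‖z‖ ^ 3)
    (h3 : 3 * ε₁ ≤ R) (hδε : deltaOf A₁ p₀ ‖g‖ ≤ ε₁)
    {B : E} (hB : ‖B‖ ≤ p0Profile A₁ p₀ ‖g‖) {s : ι → ℝ} {σ : ι → ℂ} (hsσ : (s, σ) ∈ Cstr l (Real.exp κ₁)) :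
    ‖cauchyOp (Real.exp κ₁) l (fun s σ => Qop (scaled g (W s σ)) B) s σ‖ ≤
      Real.exp (-(κ₁ - 1) * l.length) * (1 / 2 * (27 * Kc * (A₁ * (‖g‖ * xOf ‖g‖ ^ p₀)))) := by
  rw [← deltaOf_eq]
  exact norm_cauchyOp_Qop_le_exp_variant hκ hg hg1 hK0 hR hA₁ hW hK h3 hδε hB hsσ

end

end Summit.QuantumFields.BalabanUV.Beta.VariantCutoffRoadColumns
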